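import Literature.NumberTheory.PAdicHodge.BdRPlusFormalLogThetaKernel
import Literature.NumberTheory.PAdicHodge.BdRPlusLogTeichUnit
import Literature.NumberTheory.PAdicHodge.BdRPlusLogTeich
import HarnessLib

/-!
# Fontaine's integrating element versus K1's: `log_W(ι[ũ]) ≡ b_ω + ι_F(log_ω P) (mod Fil^k B_dR⁺)`

Topic `Literature/NumberTheory/PAdicHodge`; namespace `Literature.NumberTheory.PAdicHodge.GaloisContinuity`. THEOREMS ONLY (no definition, no instance,
no named fact, no `sorry`). K1 (`AinfWeierstrassKummerIntegral`) integrates the Kummer cocycle of a `[p]`-division sequence `u` of a point `P = u₀` of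
`Ŵ(𝔪_{ℂ_F})` by `b_ω := log_W(ι z_u) ∈ Fil¹ B_dR⁺`, `z_u = [ũ] − Q` for a `Γ_F`-FIXED lift `Q ∈ Ŵ(𝔫)` of `u₀` (`AinfTop.bOmega`; `σ b_ω − b_ω = ∫_{κ_u(σ)} ω`),
and records in its docstring that Fontaine's own integrating element `log_W(ι[ũ])` «differs from `b_ω` by the `Γ_F`-invariant constant `log_ω(P) ∈ F`,
which re-enters only in the explicit reciprocity law». With the `p`-adic evaluation `IsFormalLogModFil` (`BdRPlusFormalLogModFil`, values `L` of
`log_W(ι[ũ])` modulo `Fil^k`), its `θ`-value (`BdRPlusFormalLogTheta`: `θ(L) = ι_F(log_ω P)`) and Tate's `H⁰(Γ_F, ker θ / Fil^k) = 0`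
(`mem_span_xiBdR_pow_of_forall_galBdRPlus_sub_mem`, `BdRPlusLogTeichUnit`) this becomes a theorem:

* ★ `IsFormalLogModFil.sub_bOmega_sub_mem` — `L − b_ω − L_Q ∈ ξ^k B_dR⁺` for any values `L` at `[ũ]` and `L_Q` at `Q` (`θ(Q) = u₀`, `‖u₀‖ ≤ ‖p‖`;
  additivity at `z_u + Q = [ũ]`); `IsFormalLogModFil.thetaBdR_eq_thetaBdR_of_lift` (`θ(L_Q) = θ(L)`, as `b_ω ∈ Fil¹`);
  `IsFormalLogModFil.galBdRPlus_sub_mem_of_galPtN_eq` (`σ L_Q − L_Q ∈ ξ^k` for a `Γ_F`-fixed `Q`);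
* ★★ `IsFormalLogModFil.sub_bOmega_sub_embBdRHom_mem` — if `Q` is `Γ_F`-fixed and `θ(L) = ι(a)` for some `a ∈ F`, then
  **`L − b_ω − ι_F(a) ∈ ξ^k B_dR⁺`** (`ι_F = embBdRHom`): `L_Q − ι_F(a)` is `Γ_F`-invariant modulo `ξ^k` with `θ = 0`, hence in `ξ^k` by Tate;
* ★★★ `IsFormalLogModFil.sub_bOmega_sub_embBdRHom_padicLogPointFiniteExt_mem` — for an `F`-RATIONAL point `P ∈ E⁽ᵖ⁾(F)` of `E = W ⊗ F`, `u` a division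
  sequence of its image and `Q` any `Γ_F`-fixed lift of `u₀`: **`log_W(ι[ũ]) ≡ b_ω + ι_F(log_ω P) (mod ξ^k B_dR⁺)`**,
  `log_ω = FormalGroupChart.padicLogPointFiniteExt w (curveF F W) p` — the `log_ω` of Kato's reciprocity law [REC]; `…_zpPt` — the case `Q = P_c` of a
  `ℚ_p`-rational parameter `p·c` (K1's `AinfTop.zpPt`, `galPtN_zpPt`).

So the `ω`-coordinate `b_ω` of K1's element `x_P` (floor (H1)/(H3) of the B₂ road) and Fontaine's integrating element of (H4) differ exactly by the constant
`ι_F(log_ω P)`: memo `Summits/…/Cruxes/StarredOptimalManinUnitFiveSeven/Lines/kato-lever-K3-H4-theta.md` §2 (crux K★ `stmt-BirchSwinnertonDyer-22226`).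
Infrastructure only; BSD / K★ are not proved by any of this.

## References
* S. Bloch, K. Kato, *L-functions and Tamagawa numbers of motives* (1990), Ex. 3.10.1, (3.11.1). [BlochKato1990]
* J.-M. Fontaine, *Formes différentielles et modules de Tate…*, Invent. Math. 65 (1982), §5. [Fontaine1982FormesDifferentielles]
* J. Tate, *p-divisible groups* (1967), §3.3 Thm. 2 (`H⁰(Γ_F, ℂ_F(1)) = 0`). [Tate1967]
* K. Kato, LNM 1553 (1993), Ch. II Lemma 1.4.3. [Kato1993LNM1553]
-/

noncomputable section

namespace Literature.NumberTheory.PAdicHodge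

namespace GaloisContinuity

open scoped NNReal Classical
open ValuativeRel Field Ideal WittVector Filter
open _root_.Topology
open Literature.NumberTheory.GaloisRepresentations Literature.NumberTheory.GaloisRepresentations.IsNonarchimedeanLocalField
open Literature.NumberTheory.GaloisRepresentations.LubinTate
open Literature.NumberTheory.EllipticCurves Literature.NumberTheory.EllipticCurves.FormalGroupChart

variable {F : Type} [Field F] [ValuativeRel F] [TopologicalSpace F] [IsNonarchimedeanLocalField F]
  [CharZero F] {p : ℕ} [Fact p.Prime] [Fact (¬ IsUnit (p : integerC F))]
  [IsAdicComplete (Ideal.span {(p : integerC F)}) (integerC F)]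
  {hθ : Function.Surjective (fontaineTheta (integerC F) p)} (W : WeierstrassCurve ℤ)
  {u : ℕ → (maxNilIdealC F).toIdeal} (hup : ∀ n, AinfTop.mulPC F p W (u (n + 1)) = u n) {Q : W.Pt (AinfTop.nilTheta F p hθ)}

/-! ## §1 `L ≡ b_ω + L_Q` for any lift `Q` of the base point -/

/-- A lift `Q ∈ Ŵ(𝔫)` of `u₀ ∈ Ŵ(p𝒪_{ℂ_F})` has its coordinate in `(p, ξ)`. [cite: Fontaine1982FormesDifferentielles, §5] -/
theorem mem_span_p_xi_of_thetaPt_eq (hQ : AinfTop.thetaPt W hθ Q = ⟨u 0⟩)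
    (hu : ‖(((u 0 : (maxNilIdealC F).toIdeal) : CBall F) : CompletedAlgClosure F)‖ ≤ ‖(p : CompletedAlgClosure F)‖) :
    (AinfTop.of F p).symm (Q.val : AinfTop F p) ∈ Ideal.span {(p : Ainf (p := p) F), xi} :=
  mem_span_p_xi_of_norm_thetaPt_le W (by rw [hQ]; exact hu)

/-- ★ **`L − b_ω − L_Q ∈ ξ^k B_dR⁺`**: for a lift `Q ∈ Ŵ(𝔫)` of `u₀` (`θ(Q) = u₀`, `‖u₀‖ ≤ ‖p‖`), a value `L` of `log_W(ι[ũ])` and a value `L_Q` of `log_W(ι Q)`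
modulo `Fil^k`, K1's `b_ω = log_W(ι([ũ] − Q))` satisfies `L ≡ b_ω + L_Q` (additivity at `([ũ] − Q) ⊕ Q = [ũ]`, `isFormalLogModFil_logKer`, uniqueness).
[cite: Fontaine1982FormesDifferentielles, §5] [cite: BlochKato1990, Ex. 3.10.1] -/
theorem IsFormalLogModFil.sub_bOmega_sub_mem {k : ℕ} (hQ : AinfTop.thetaPt W hθ Q = ⟨u 0⟩)
    (hu : ‖(((u 0 : (maxNilIdealC F).toIdeal) : CBall F) : CompletedAlgClosure F)‖ ≤ ‖(p : CompletedAlgClosure F)‖)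
    {L : BDeRhamPlus (integerC F) p} (hL : IsFormalLogModFil W k ((AinfTop.of F p).symm (AinfTop.torsionLift W hθ u hup)) L)
    {LQ : BDeRhamPlus (integerC F) p} (hLQ : IsFormalLogModFil W k ((AinfTop.of F p).symm (Q.val : AinfTop F p)) LQ) :
    L - (BdRPlusTop.of F p).symm (AinfTop.bOmega W hup hQ) - LQ ∈ Ideal.span {(xiBdR : BDeRhamPlus (integerC F) p) ^ k} := by
  -- `b_ω` is a value at `z_u = [ũ] − Q`
  have hb : IsFormalLogModFil W k ((AinfTop.of F p).symm ((AinfTop.kummerIntegralPt W hup Q).val : AinfTop F p))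
      ((BdRPlusTop.of F p).symm (AinfTop.bOmega W hup hQ)) :=
    isFormalLogModFil_logKer W k _ (AinfTop.thetaPt_kummerIntegralPt W hup hQ)
  -- coordinates in `(p, ξ)`
  have hzI : (AinfTop.of F p).symm ((AinfTop.kummerIntegralPt W hup Q).val : AinfTop F p) ∈ Ideal.span {(p : Ainf (p := p) F), xi} :=
    mem_span_p_xi_of_norm_thetaPt_le W (by
      rw [AinfTop.thetaPt_kummerIntegralPt W hup hQ, WeierstrassCurve.Pt.val_zero, ZeroMemClass.coe_zero, ZeroMemClass.coe_zero, norm_zero]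
      exact norm_nonneg _)
  have hsum := IsFormalLogModFil.addW W hzI (mem_span_p_xi_of_thetaPt_eq W hQ hu) hb hLQ
  have hpt : AinfTop.kummerIntegralPt W hup Q + Q = AinfTop.divisionLiftPt W hθ u hup := by
    rw [AinfTop.kummerIntegralPt_def, sub_add_cancel]
  rw [← AinfTop.val_add_N, hpt, AinfTop.coe_val_divisionLiftPt] at hsum
  have h := hL.sub_mem_span_xiBdR_pow hsum
  rwa [← sub_sub] at h

/-- `θ(b_ω) = 0` (`b_ω ∈ Fil¹ = ker θ`). [cite: Fontaine1982FormesDifferentielles, §5] -/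
theorem thetaBdR_of_symm_bOmega (hQ : AinfTop.thetaPt W hθ Q = ⟨u 0⟩) :
    thetaBdR ((BdRPlusTop.of F p).symm (AinfTop.bOmega W hup hQ)) = 0 := by
  rw [mem_ker_thetaBdR_iff, ← BdRPlusTop.mem_filOne_iff]
  exact AinfTop.bOmega_mem_filOne W hup hQ

/-- **`θ(L_Q) = θ(L)`** for values at a lift `Q` of `u₀` and at `[ũ]` (`k ≥ 1`; `L ≡ b_ω + L_Q`, `θ(b_ω) = 0`). [cite: Fontaine1982FormesDifferentielles, §5] -/
theorem IsFormalLogModFil.thetaBdR_eq_thetaBdR_of_lift {k : ℕ} (hk : 1 ≤ k) (hQ : AinfTop.thetaPt W hθ Q = ⟨u 0⟩)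
    (hu : ‖(((u 0 : (maxNilIdealC F).toIdeal) : CBall F) : CompletedAlgClosure F)‖ ≤ ‖(p : CompletedAlgClosure F)‖)
    {L : BDeRhamPlus (integerC F) p} (hL : IsFormalLogModFil W k ((AinfTop.of F p).symm (AinfTop.torsionLift W hθ u hup)) L)
    {LQ : BDeRhamPlus (integerC F) p} (hLQ : IsFormalLogModFil W k ((AinfTop.of F p).symm (Q.val : AinfTop F p)) LQ) :
    thetaBdR LQ = thetaBdR L := by
  have h0 := thetaBdR_eq_zero_of_mem_span_xiBdR_pow hk (hL.sub_bOmega_sub_mem W hup hQ hu hLQ)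
  rw [map_sub, map_sub, thetaBdR_of_symm_bOmega W hup hQ, sub_zero, sub_eq_zero] at h0
  exact h0.symm

/-- **`σ L_Q − L_Q ∈ ξ^k B_dR⁺`** for a value `L_Q` at a `Γ_F`-FIXED point `Q ∈ Ŵ(𝔫)` (`σ L_Q` is a value at `σ Q = Q`; uniqueness).
[cite: Fontaine1982FormesDifferentielles, §5] -/
theorem IsFormalLogModFil.galBdRPlus_sub_mem_of_galPtN_eq {k : ℕ} (hQσ : ∀ σ : absoluteGaloisGroup F, AinfTop.galPtN W hθ σ Q = Q)
    {LQ : BDeRhamPlus (integerC F) p} (hLQ : IsFormalLogModFil W k ((AinfTop.of F p).symm (Q.val : AinfTop F p)) LQ) (σ : absoluteGaloisGroup F) :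
    PAdicHodge.galBdRPlus σ LQ - LQ ∈ Ideal.span {(xiBdR : BDeRhamPlus (integerC F) p) ^ k} := by
  have h : IsFormalLogModFil W k ((AinfTop.of F p).symm ((AinfTop.galPtN W hθ σ Q).val : AinfTop F p)) (PAdicHodge.galBdRPlus σ LQ) := by
    rw [AinfTop.coe_val_galPtN]
    exact hLQ.galBdRPlus σ
  rw [hQσ σ] at h
  exact h.sub_mem_span_xiBdR_pow hLQ

/-! ## §2 `L ≡ b_ω + ι_F(a)` when `θ(L) = ι(a)` and `Q` is `Γ_F`-fixed -/

/-- ★★ **`L − b_ω − ι_F(a) ∈ ξ^k B_dR⁺`.** Let `Q ∈ Ŵ(𝔫)` be a `Γ_F`-FIXED lift of `u₀` (`‖u₀‖ ≤ ‖p‖`), `k ≥ 1`, `L` a value of `log_W(ι[ũ])` modulo `Fil^k`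
with `θ(L) = ι(a)`, `a ∈ F`. Then `L ≡ b_ω + embBdRHom(a) (mod ξ^k)`: a value `L_Q` at `Q` has `θ(L_Q − ι_F a) = 0` and `(σ − 1)(L_Q − ι_F a) ∈ ξ^k`, so
`L_Q − ι_F a ∈ ξ^k` by Tate's `H⁰(Γ_F, ker θ/Fil^k) = 0` (`mem_span_xiBdR_pow_of_forall_galBdRPlus_sub_mem`). [cite: Fontaine1982FormesDifferentielles, §5]
[cite: Tate1967, §3.3 Thm. 2] [cite: BlochKato1990, Ex. 3.10.1] -/
theorem IsFormalLogModFil.sub_bOmega_sub_embBdRHom_mem (hp : valuation F p < 1) {k : ℕ} (hk : 1 ≤ k)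
    (hQ : AinfTop.thetaPt W hθ Q = ⟨u 0⟩) (hQσ : ∀ σ : absoluteGaloisGroup F, AinfTop.galPtN W hθ σ Q = Q)
    (hu : ‖(((u 0 : (maxNilIdealC F).toIdeal) : CBall F) : CompletedAlgClosure F)‖ ≤ ‖(p : CompletedAlgClosure F)‖)
    {L : BDeRhamPlus (integerC F) p} (hL : IsFormalLogModFil W k ((AinfTop.of F p).symm (AinfTop.torsionLift W hθ u hup)) L)
    {a : F} (hθL : thetaBdR L = algebraMap F (CompletedAlgClosure F) a) :
    L - (BdRPlusTop.of F p).symm (AinfTop.bOmega W hup hQ) - embBdRHom hp hθ a ∈ Ideal.span {(xiBdR : BDeRhamPlus (integerC F) p) ^ k} := by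
  obtain ⟨LQ, hLQ⟩ := exists_isFormalLogModFil W (mem_span_p_xi_of_thetaPt_eq W hQ hu) k
  have h1 := hL.sub_bOmega_sub_mem W hup hQ hu hLQ
  have hD : LQ - embBdRHom hp hθ a ∈ Ideal.span {(xiBdR : BDeRhamPlus (integerC F) p) ^ k} := by
    refine mem_span_xiBdR_pow_of_forall_galBdRPlus_sub_mem hp hθ ?_ k fun σ => ?_
    · rw [map_sub, thetaBdR_embBdRHom, hL.thetaBdR_eq_thetaBdR_of_lift W hup hk hQ hu hLQ, hθL, sub_self]
    · rw [map_sub, galBdRPlus_embBdRHom, sub_sub_sub_cancel_right]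
      exact IsFormalLogModFil.galBdRPlus_sub_mem_of_galPtN_eq W hQσ hLQ σ
  have e : L - (BdRPlusTop.of F p).symm (AinfTop.bOmega W hup hQ) - embBdRHom hp hθ a =
      (L - (BdRPlusTop.of F p).symm (AinfTop.bOmega W hup hQ) - LQ) + (LQ - embBdRHom hp hθ a) := by ring
  rw [e]
  exact Ideal.add_mem _ h1 hD

/-! ## §3 `F`-rational points: `log_W(ι[ũ]) ≡ b_ω + ι_F(log_ω P)` -/

omit [Fact (¬ IsUnit (p : integerC F))] [IsAdicComplete (Ideal.span {(p : integerC F)}) (integerC F)] [CharZero F] [Fact p.Prime] in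
/-- A point of the level `E⁽ᵖ⁾(F)` has `‖ι z(P)‖ ≤ ‖p‖` in `ℂ_F`. [cite: SilvermanAEC2009, Prop. VII.2.2] -/
theorem norm_algebraMap_zCoord_le_of_mem_level (w : Valuation F ℝ≥0) [w.Compatible] [(AinfTop.curveF F W).IsIntegral w.integer]
    {P : (AinfTop.curveF F W).toAffine.Point} (hP : P ∈ level w (AinfTop.curveF F W) (w (p : F))) :
    ‖algebraMap F (CompletedAlgClosure F) P.zCoord‖ ≤ ‖(p : CompletedAlgClosure F)‖ := by
  rw [← map_natCast (algebraMap F (CompletedAlgClosure F)) p, norm_algebraMap_le_iff_val_le w]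
  exact hP.2

/-- ★★★ **`log_W(ι[ũ]) ≡ b_ω + ι_F(log_ω P) (mod ξ^k B_dR⁺)` for an `F`-rational point.** Let `E = W ⊗ F` (`curveF F W`), `w` a compatible valuation of `F`,
`P ∈ E⁽ᵖ⁾(F)`, `u` a `[p]`-division sequence in `Ŵ(𝔪_{ℂ_F})` of the image of `P` (`u₀ = ι z(P)`), `Q ∈ Ŵ(𝔫)` a `Γ_F`-fixed lift of `u₀`, `k ≥ 1`, and `L` a value of
`log_W(ι[ũ])` modulo `Fil^k`. Then **`L − b_ω − embBdRHom(log_ω P) ∈ ξ^k B_dR⁺`** with `log_ω = padicLogPointFiniteExt w (curveF F W) p` — K1's docstring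
«Fontaine's integrating element differs from `b_ω` by the `Γ_F`-invariant constant `log_ω(P) ∈ F`» as a theorem. [cite: Fontaine1982FormesDifferentielles, §5]
[cite: BlochKato1990, Ex. 3.10.1, (3.11.1)] [cite: Kato1993LNM1553, Ch. II Lemma 1.4.3] -/
theorem IsFormalLogModFil.sub_bOmega_sub_embBdRHom_padicLogPointFiniteExt_mem (hp : valuation F p < 1)
    [(curveOver (CompletedAlgClosure F) W).IsElliptic] {k : ℕ} (hk : 1 ≤ k) (w : Valuation F ℝ≥0) [w.Compatible]
    [(AinfTop.curveF F W).IsIntegral w.integer] {P : (AinfTop.curveF F W).toAffine.Point} (hP : P ∈ level w (AinfTop.curveF F W) (w (p : F)))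
    (hu₀ : (((u 0 : (maxNilIdealC F).toIdeal) : CBall F) : CompletedAlgClosure F) = algebraMap F (CompletedAlgClosure F) P.zCoord)
    (hQ : AinfTop.thetaPt W hθ Q = ⟨u 0⟩) (hQσ : ∀ σ : absoluteGaloisGroup F, AinfTop.galPtN W hθ σ Q = Q)
    {L : BDeRhamPlus (integerC F) p} (hL : IsFormalLogModFil W k ((AinfTop.of F p).symm (AinfTop.torsionLift W hθ u hup)) L) :
    L - (BdRPlusTop.of F p).symm (AinfTop.bOmega W hup hQ) - embBdRHom hp hθ (padicLogPointFiniteExt w (AinfTop.curveF F W) p P) ∈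
      Ideal.span {(xiBdR : BDeRhamPlus (integerC F) p) ^ k} :=
  hL.sub_bOmega_sub_embBdRHom_mem W hup hp hk hQ hQσ (by rw [hu₀]; exact norm_algebraMap_zCoord_le_of_mem_level W w hP)
    (hL.thetaBdR_eq_algebraMap_padicLogPointFiniteExt W hp hk w hP hup hu₀)

/-- ★★ **The `ℚ_p`-rational case `Q = P_c`** (K1 `AinfTop.zpPt`: the `Γ_F`-fixed constant point with parameter `p·c`, `c ∈ ℤ_p`): for `P ∈ E⁽ᵖ⁾(F)` with
`ι z(P) = θ(p·c) = u₀` and `L` a value of `log_W(ι[ũ])` modulo `Fil^k`, **`L − b_ω − ι_F(log_ω P) ∈ ξ^k B_dR⁺`** with `b_ω = AinfTop.bOmega` relative to `P_c`.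
[cite: BlochKato1990, Ex. 3.10.1, (3.11.1)] [cite: Kato1993LNM1553, Ch. II Lemma 1.4.3] -/
theorem IsFormalLogModFil.sub_bOmega_zpPt_sub_embBdRHom_padicLogPointFiniteExt_mem (hp : valuation F p < 1)
    [(curveOver (CompletedAlgClosure F) W).IsElliptic] {k : ℕ} (hk : 1 ≤ k) (w : Valuation F ℝ≥0) [w.Compatible]
    [(AinfTop.curveF F W).IsIntegral w.integer] {P : (AinfTop.curveF F W).toAffine.Point} (hP : P ∈ level w (AinfTop.curveF F W) (w (p : F)))
    (hu₀ : (((u 0 : (maxNilIdealC F).toIdeal) : CBall F) : CompletedAlgClosure F) = algebraMap F (CompletedAlgClosure F) P.zCoord)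
    (c : ℤ_[p]) (hQ : AinfTop.thetaPt W hθ (AinfTop.zpPt W hθ c) = ⟨u 0⟩)
    {L : BDeRhamPlus (integerC F) p} (hL : IsFormalLogModFil W k ((AinfTop.of F p).symm (AinfTop.torsionLift W hθ u hup)) L) :
    L - (BdRPlusTop.of F p).symm (AinfTop.bOmega W hup hQ) - embBdRHom hp hθ (padicLogPointFiniteExt w (AinfTop.curveF F W) p P) ∈
      Ideal.span {(xiBdR : BDeRhamPlus (integerC F) p) ^ k} :=
  hL.sub_bOmega_sub_embBdRHom_padicLogPointFiniteExt_mem W hup hp hk w hP hu₀ hQ (fun σ => AinfTop.galPtN_zpPt W σ c)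

end GaloisContinuity

end Literature.NumberTheory.PAdicHodge

end
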